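import Mathlib

/-!
# The garbage wall, `G`-form: in a left-`H`-invariant test space the `|H|·|Z|` targets are free
# (crux `LevelGradedCohnUmans.GradedDesignFamily`, stmt-MatrixMultiplication-7610; negative side,
# line `quadratic-extension-level-one-cell`, lead c8; stub `garbage_wall`)

Let `H ≤ G` be a subgroup of a finite group, `J ≤ ℂ^G` a LEFT-`H`-INVARIANT subspace
(`f ∈ J`, `h ∈ H` ⟹ `(g ↦ f (h g)) ∈ J`), `Y, Z ⊆ G` finite sets with `Y ≠ ∅`, and suppose every
target `z₀ ∈ Z` has a separator `F ∈ J` with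
`F(h · (y y'⁻¹ z)) = [h = 1 ∧ y = y' ∧ z = z₀]` for `h ∈ H`, `y, y' ∈ Y`, `z ∈ Z`.
Then for every finite set `S` of GARBAGE words `h · (y y'⁻¹ z)` (`h ∈ H`, `y, y' ∈ Y`, `z ∈ Z`,
`y ≠ y'`),

* `garbage_wall` — `|H|·|Z| + dim (J|_S) ≤ dim J`,

where `J|_S = J.map (funLeft (↑))` is the space of restrictions to `S` of functions in `J`.
This is the `G`-form of the shadow wall `shadow_wall` (`Negative/ShadowWall.lean`): the garbage set
has corank `≥ |H|·|Z|` in the invariant test space, however large it is — step (i) of strong garbage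
confinement (`rank (Γ) ≤ D − |H||Z|`).

PROOF (the proof of `shadow_wall` with the index set `Z` replaced by `H × Z`).  Pick `y₁ ∈ Y` and,
for `z₀ ∈ Z`, a separator `F_{z₀}`; left-translate: `F_{h₀,z₀} := (g ↦ F_{z₀}(h₀⁻¹ g)) ∈ J` by
invariance (`h₀⁻¹ ∈ H`), and for `h ∈ H`
`F_{h₀,z₀}(h · (y y'⁻¹ z)) = F_{z₀}((h₀⁻¹ h) · (y y'⁻¹ z)) = [h₀⁻¹ h = 1 ∧ y = y' ∧ z = z₀]
 = [h₀ = h ∧ y = y' ∧ z = z₀]`.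
Evaluation at the `|H|·|Z|` words `h₀ · (y₁ y₁⁻¹ z₀)`, `Φ₁ f := (f(h₀ · (y₁ y₁⁻¹ z₀)))_{(h₀,z₀)}`,
maps `J` ONTO `ℂ^{H × Z}` (`Φ₁ F_{h₀,z₀}` is the coordinate vector of `(h₀, z₀)`), so
`dim J = |H|·|Z| + dim ker Φ₁`; and restriction to `S`, `Φ₂`, kills every `F_{h₀,z₀}` (a garbage
word has `y ≠ y'`), hence `Φ₂ f = Φ₂ (f − Σ_r Φ₁(f)_r · F_r)` with `f − Σ_r Φ₁(f)_r F_r ∈ ker Φ₁`: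
`J|_S = Φ₂(ker Φ₁)` has dimension `≤ dim ker Φ₁`.

Sorry-free; axioms `propext`, `Classical.choice`, `Quot.sound`.
-/

set_option linter.dupNamespace false

noncomputable section

open scoped BigOperators
open Module

namespace Summit.MatrixMultiplication.MatrixMultiplication.Theorems.GradedDesignFamily.Negative

/-- **The garbage wall (`G`-form of the shadow wall).**  If `J ≤ ℂ^G` is left-`H`-invariant,
every target `z₀ ∈ Z` has a separator `F ∈ J` with `F(h · (y y'⁻¹ z)) = [h = 1 ∧ y = y' ∧ z = z₀]`
for `h ∈ H` on `Y × Y × Z` (`Y ≠ ∅`), and `S` is a finite set of garbage words `h · (y y'⁻¹ z)`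
with `h ∈ H`, `y ≠ y'`, then `|H|·|Z| + dim J|_S ≤ dim J`. -/
theorem garbage_wall :
    ∀ {G : Type} [Group G] [Fintype G] [DecidableEq G] (H : Subgroup G) (J : Submodule ℂ (G → ℂ)),
      (∀ f ∈ J, ∀ h : G, h ∈ H → (fun g => f (h * g)) ∈ J) →
      ∀ (Y Z : Finset G), Y.Nonempty →
      (∀ z₀ ∈ Z, ∃ F ∈ J, ∀ h : G, h ∈ H → ∀ y ∈ Y, ∀ y' ∈ Y, ∀ z ∈ Z,
        F (h * (y * y'⁻¹ * z)) = if (h = 1 ∧ y = y' ∧ z = z₀) then 1 else 0) →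
      ∀ (S : Finset G),
      (∀ s ∈ S, ∃ h : G, h ∈ H ∧ ∃ y ∈ Y, ∃ y' ∈ Y, ∃ z ∈ Z, y ≠ y' ∧ s = h * (y * y'⁻¹ * z)) →
      Nat.card H * Z.card + Module.finrank ℂ (J.map (LinearMap.funLeft ℂ ℂ ((↑) : ↥S → G))) ≤
        Module.finrank ℂ J := by
  intro G _ _ _ H J hinv Y Z hY hsep S hS
  classical
  obtain ⟨y₁, hy₁⟩ := hY
  -- translated separators, one per target `(h₀, z₀) ∈ H × Z`
  let R : Type := ↥H × ↥Z
  have hrow : ∀ r : R, ∃ f : J, ∀ h : G, h ∈ H → ∀ y ∈ Y, ∀ y' ∈ Y, ∀ z ∈ Z,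
      (f : G → ℂ) (h * (y * y'⁻¹ * z)) =
        if ((r.1 : G) = h ∧ y = y' ∧ z = (r.2 : G)) then 1 else 0 := by
    intro r
    obtain ⟨F, hFJ, hF⟩ := hsep (r.2 : G) r.2.2
    refine ⟨⟨fun g => F ((r.1 : G)⁻¹ * g), hinv F hFJ (r.1 : G)⁻¹ (H.inv_mem r.1.2)⟩, ?_⟩
    intro h hh y hy y' hy' z hz
    show F ((r.1 : G)⁻¹ * (h * (y * y'⁻¹ * z))) = _
    rw [← mul_assoc ((r.1 : G)⁻¹) h (y * y'⁻¹ * z),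
      hF ((r.1 : G)⁻¹ * h) (H.mul_mem (H.inv_mem r.1.2) hh) y hy y' hy' z hz]
    exact if_congr (by rw [inv_mul_eq_one]) rfl rfl
  choose f hf using hrow
  -- Φ₁ : evaluation at the target words `h₀ · (y₁ y₁⁻¹ z₀)`
  let Φ₁ : J →ₗ[ℂ] (R → ℂ) := LinearMap.pi fun r : R =>
    (LinearMap.proj ((r.1 : G) * (y₁ * y₁⁻¹ * (r.2 : G))) : (G → ℂ) →ₗ[ℂ] ℂ).comp J.subtype
  have hΦ₁ : ∀ (φ : J) (r : R), Φ₁ φ r = (φ : G → ℂ) ((r.1 : G) * (y₁ * y₁⁻¹ * (r.2 : G))) :=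
    fun φ r => rfl
  have hΦ₁f : ∀ r₀ r : R, Φ₁ (f r₀) r = if r = r₀ then 1 else 0 := by
    intro r₀ r
    rw [hΦ₁, hf r₀ (r.1 : G) r.1.2 y₁ hy₁ y₁ hy₁ (r.2 : G) r.2.2]
    by_cases hrr : r = r₀
    · subst hrr; simp
    · rw [if_neg hrr, if_neg]
      rintro ⟨hh, -, hz⟩
      exact hrr (Prod.ext (Subtype.ext hh.symm) (Subtype.ext hz))
  have hsurj : Function.Surjective Φ₁ := by
    intro w
    refine ⟨∑ r, w r • f r, ?_⟩
    rw [map_sum]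
    funext r₀
    simp only [map_smul, Finset.sum_apply, Pi.smul_apply, hΦ₁f, smul_eq_mul, mul_ite, mul_one,
      mul_zero]
    rw [Finset.sum_ite_eq]
    simp
  -- Φ₂ : restriction to the garbage set `S`; it kills every translated separator
  let Φ₂ : J →ₗ[ℂ] (↥S → ℂ) := (LinearMap.funLeft ℂ ℂ ((↑) : ↥S → G)).comp J.subtype
  have hΦ₂ : ∀ (φ : J) (s : ↥S), Φ₂ φ s = (φ : G → ℂ) s := fun φ s => rfl
  have hΦ₂f : ∀ r : R, Φ₂ (f r) = 0 := by
    intro r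
    funext s
    obtain ⟨h, hh, y, hy, y', hy', z, hz, hne, hs⟩ := hS s s.2
    rw [hΦ₂, Pi.zero_apply, hs, hf r h hh y hy y' hy' z hz, if_neg]
    rintro ⟨-, hyy, -⟩
    exact hne hyy
  -- range Φ₂ = Φ₂ (ker Φ₁)
  have hrange : LinearMap.range Φ₂ ≤ LinearMap.range (Φ₂.comp (LinearMap.ker Φ₁).subtype) := by
    rintro _ ⟨φ, rfl⟩
    have hker : φ - ∑ r, Φ₁ φ r • f r ∈ LinearMap.ker Φ₁ := by
      rw [LinearMap.mem_ker, map_sub, map_sum, sub_eq_zero]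
      funext r₀
      simp only [map_smul, Finset.sum_apply, Pi.smul_apply, hΦ₁f, smul_eq_mul, mul_ite, mul_one,
        mul_zero]
      rw [Finset.sum_ite_eq]
      simp
    refine ⟨⟨_, hker⟩, ?_⟩
    rw [LinearMap.comp_apply, Submodule.subtype_apply, map_sub, map_sum]
    simp only [map_smul, hΦ₂f, smul_zero, Finset.sum_const_zero, sub_zero]
  -- bookkeeping
  have hmap : J.map (LinearMap.funLeft ℂ ℂ ((↑) : ↥S → G)) = LinearMap.range Φ₂ := by
    rw [LinearMap.range_comp, Submodule.range_subtype]
  have h1 : finrank ℂ (LinearMap.range Φ₂) ≤ finrank ℂ (LinearMap.ker Φ₁) :=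
    (Submodule.finrank_mono hrange).trans (LinearMap.finrank_range_le _)
  have hrn := LinearMap.finrank_range_add_finrank_ker Φ₁
  rw [LinearMap.range_eq_top.mpr hsurj, finrank_top, Module.finrank_fintype_fun_eq_card] at hrn
  have hR : Fintype.card R = Nat.card H * Z.card := by
    show Fintype.card (↥H × ↥Z) = _
    rw [Fintype.card_prod, Fintype.card_coe, Nat.card_eq_fintype_card]
  rw [hmap, ← hrn, ← hR]
  omega

end Summit.MatrixMultiplication.MatrixMultiplication.Theorems.GradedDesignFamily.Negative

end
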